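import Mathlib
import Summits.QuantumFields.BalabanUV.T4Continuum.Support.SliceTorusBlocks
import Summits.QuantumFields.BalabanUV.T4Continuum.Support.SliceTorusBlockModel

/-!
# T⁴ programme, node NE3 — the slice-operator TORUS MODEL, file 3/4: the NESTED PERIODIC TORUS and
# `sliceKernel_bound_of_printedType` WITH ITS GEOMETRY BINDERS SUPPLIED

Series purpose, dictionary and printed wordings [R]: header of `SliceTorusBlocks` (file 1/4).  THIS FILE [model geometry,
proved]: §4 the fine lattice `X = (ℤ/NLⁿ)^d` (`TPt d (N·Lⁿ)`), level-`j` blocks of side `L^{min(j,n)}` indexed by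
`(ℤ/N·L^{n−j})^d` through the block map `cube j` (`fine_eq_levM_mul_side`: the blocks tile the torus exactly at EVERY
level, the levels `j ≥ n` being the `N^d` coarsest blocks), `ρ = ` periodic ℓ¹ distance `pl1` (`rho`), `nbd j = ` INTEGER
periodic ℓ¹ distance of block indices; the level-`j` geometry `torusGeom … Mbig dist j := blockGeom (cube j) (dist j) j L
Mbig` with a FREE level-indexed site distance `dist j`.  THE BINDERS ARE THEOREMS: `rho_nonneg`, `rho_comm`,
`rho_triangle`; `len_torusGeom`; `nbd_le_nbdDist` (`hbd` for `dist := nbdDist`, `le_rfl`); `rho_le_nbd` — **`ρ(x,z) ≤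
L^j·nbd(cube x, cube z) + d·L^j`** (`c = d`); `card_nbd_eq_le` — **at most `2^d(r+1)^d` blocks at block distance exactly
`r`** (`A′ = 2^d`, `p = d`, uniformly in level and volume); `cube_nest`; `rho_le_of_cube_succ_eq` — **a level-`(j+1)`
block has `ρ`-diameter `≤ d·L^{j+1}`**.  MAIN: `sliceKernel_bound_torus_of_printedType` = `T4SliceOperatorData.
sliceKernel_bound_of_printedType` ON THE TORUS with the binders supplied — hypotheses left: `h342`/`h349` for the matrix
carriers at the configurations `U j` (printed TYPE, by name, LEVEL-FREE constants), `hbd : nbd j ≤ dist j`, the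
identifications `A j 0 (U j) = G j`, `A j 1 (U j) = (G j·D)ᵀ`, `F j 3 (U j) = N_j`, and the operator model `K j =
massKernel (cube j) (τ j) (a_j/(L^j)^{d+2}) + N_j` (`|τ| ≤ 1`, `0 ≤ a_j ≤ a`); conclusion: King's (3.63) shape
`|sliceKernel G K D i x y| ≤ C_A(1 + C_A·C_P)e^{−δρ(x,y)/L^i}/(L^i)^{d−1}` for EVERY slice, `C_A = printedCA B₀ δ₀ δ d 2^d
d`, `C_P = printedCP a C₃ δ₁ δ L d d`.  §5c NO HIDDEN STRENGTH: `thm31Printed_torus_of_rowBounds`,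
`stmt349Printed_torus_of_entryBounds` — the printed family statements for the model family FOLLOW from level-free
kernel-form bounds at every configuration (satisfiable; exactly the kernel content up to Bałaban's thresholds).  §6
examples: the definitions compute, the bounds of file 1 are attained.

Honest framing (all four files): finite-T⁴ ultraviolet bookkeeping about MINIMISERS (rung (B)+1 of the cell's ladder); no
conditional of the cell (`BetaPertH`, (B), (B^μ)) is used or hidden; nothing bears on infinite volume, a mass gap, or the
Clay problem; NE3 is NOT proved — the value is a typed skeleton with the gap located (the hypotheses of
`SliceTorusSkeleton.ne3Shape_torus_of_printedStatements`).  ABSOLUTE RULE of the cell kept: no internally-minted statement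
enters as a cited fact; B9's theorems enter only as HYPOTHESES of the tree's typed, cite-tagged shapes; the manuscripts
under audit are not cited for any disputed step.  No `sorry`, no axioms beyond Mathlib's; integer/real arithmetic, finite
sums and sups are [folklore]; every [model] sentence is dictionary, never a hypothesis discharged by citation.  PLACEMENT
(human rule 2026-08-19): new cell work lives under `Summits/QuantumFields/BalabanUV/`; this series imports the lineage's
earlier leaves where they landed (`Literature.….Balaban1983to89.T4SliceOperatorData` v1.1 p193857, `B12Decay510Torus`)
and moves nothing.  Records: `t4/T4-EST-U1b-OSC.md` v1.22 (RESULTS 28, 29), `t4/T4-EST-NE3-P1.md` v2.20, GAPS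
G-ne3p1-35/36 of the cell `pub-balaban` (HOME `run/shared/lean/pub/pub-balaban/`).
-/

noncomputable section

open Finset Real

namespace Summit.QuantumFields.BalabanUV.T4Continuum.SliceTorusTower

open Literature.MathematicalPhysics.QuantumFieldTheory.Balaban1983to89
open Literature.MathematicalPhysics.QuantumFieldTheory.Balaban1983to89.TreeLengthTorus (TPt)
open Literature.MathematicalPhysics.QuantumFieldTheory.Balaban1983to89.B12Decay510Torus
  (pabs pabs_eq_natAbs pabs_nonneg pabs_zero exists_eq_add_mul_of_cast_eq pabs_le_abs_of_cast_eq
    vmaVec vmaVec_injective pl1 pl1_eq_sum pl1_nonneg pl1_sub_comm pl1_sub_triangle)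
open Literature.MathematicalPhysics.QuantumFieldTheory.Balaban1983to89.T4SliceTelescoping
  (sliceKernel sliceConst ne3Shape_of_slices_rpow)
open Literature.MathematicalPhysics.QuantumFieldTheory.Balaban1983to89.T4EtaRateMin (Readings NE3Shape)
open Literature.MathematicalPhysics.QuantumFieldTheory.Balaban1983to89.T4FixedPointResponse (OneStepCorrectionRate)
open Literature.MathematicalPhysics.QuantumFieldTheory.Balaban1983to89.T4SliceOperatorData
open Summit.QuantumFields.BalabanUV.T4Continuum.SliceTorusBlocks Summit.QuantumFields.BalabanUV.T4Continuum.SliceTorusBlockModel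

/-! ## §4  THE NESTED PERIODIC TORUS (Bałaban's carrier `T_η`, periodic b.c.): fine lattice `(ℤ/NLⁿ)^d`, level-`j`
blocks of side `L^{min(j,n)}` indexed by `(ℤ/NL^{n−j})^d`, and the geometry binders of
`T4SliceOperatorData.sliceKernel_bound_of_printedType`, proved (`hbd` relative to a free site distance `dist j ≥ nbd j`) -/
section Tower

variable (d n N L : ℕ)

/-- Number of level-`j` blocks per direction: `N·L^{n−j}` (`= N` from level `n` on). [model] [folklore] -/
abbrev levM (j : ℕ) : ℕ := N * L ^ (n - j)

/-- Side of a level-`j` block in units of the fine lattice: `L^{min(j,n)}` (unit cubes at level `0`, the whole period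
`Lⁿ` of a coarse `N`-block from level `n` on). [model] [folklore] -/
def side (j : ℕ) : ℕ := L ^ min j n

/-- `NLⁿ = (N·L^{n−j})·L^{min(j,n)}`: the level-`j` blocks tile the fine torus exactly, at EVERY level. [folklore] -/
theorem fine_eq_levM_mul_side (j : ℕ) : N * L ^ n = levM n N L j * side n L j := by
  unfold levM side
  rw [mul_assoc, ← pow_add]
  have : n - j + min j n = n := by omega
  rw [this]

/-- **The level-`j` BLOCK MAP** `x ↦ y` with `x ∈ Δ(y) = B^j(y)`: coordinatewise `⌊x_i / L^{min(j,n)}⌋ mod N·L^{n−j}`. [model] [folklore] -/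
def cube (j : ℕ) (x : TPt d (N * L ^ n)) : TPt d (levM n N L j) := blockPt (levM n N L j) (side n L j) x

/-- **The fine distance** `ρ(x,y) = |x − y|` = periodic ℓ¹ distance on the fine torus (lattice units). [model] [folklore] -/
def rho (x y : TPt d (N * L ^ n)) : ℝ := pl1 (x - y)

/-- **The integer block distance** at level `j`: periodic ℓ¹ distance of block indices. [model] [folklore] -/
def nbd (j : ℕ) (y y₁ : TPt d (levM n N L j)) : ℕ := npl1 (y - y₁)

/-- `L^{min(j,n)} ∣ L^{min(j+1,n)}`. [folklore] -/
theorem side_dvd_side_succ (j : ℕ) : side n L j ∣ side n L (j + 1) :=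
  Nat.pow_dvd_pow L (by omega : min j n ≤ min (j + 1) n)

/-- Binder `hρ0`: `0 ≤ ρ`. [folklore] -/
theorem rho_nonneg (x y : TPt d (N * L ^ n)) : 0 ≤ rho d n N L x y := pl1_nonneg _

/-- Binder `hρsymm`: `ρ(x,y) = ρ(y,x)`. [folklore] -/
theorem rho_comm (x y : TPt d (N * L ^ n)) : rho d n N L x y = rho d n N L y x := pl1_sub_comm _ _

variable [NeZero N] [NeZero L]

/-- **The level-`j` block geometry of the torus** as a `B9.Geometry` [model]: `blockGeom` of the level-`j` block map
with a FREE level-indexed site distance `dist j` (B9's `d(y,y′)` once typed; the binder `hbd : nbd ≤ dist j` stays the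
honest hypothesis it is — for the block distance itself, `nbdDist`, it is `le_rfl`), scale `j`, `η = 1`, B9's `M` a
free parameter `Mbig` (it only enters B9's thresholds `M ≥ M₁`, `Mα₀ ≤ a₀`, which stay with the user of
`B9.Thm31Printed`, §5b).  READING [model, located — not asserted]: B9's `d(y,y′)` is the scaled tree distance
(2.36)/(2.46) of [4] = B6; its domination of the ℓ¹ block distance FROM BELOW (what `hbd` needs for the real objects)
is part of reading (I′) of the lineage records, not of this file. [model] [folklore] -/
abbrev torusGeom (Mbig : ℝ) (dist : ∀ j : ℕ, TPt d (levM n N L j) → TPt d (levM n N L j) → ℝ) (j : ℕ) :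
    B9.Geometry :=
  blockGeom (cube d n N L j) (dist j) j (L : ℝ) Mbig

/-- The integer block distance itself as the level-indexed site distance (the minimal admissible `dist`:
`nbd_le_nbdDist`). [model] [folklore] -/
abbrev nbdDist : ∀ j : ℕ, TPt d (levM n N L j) → TPt d (levM n N L j) → ℝ :=
  fun j y y₁ => (nbd d n N L j y y₁ : ℝ)

/-- A nonzero natural blocking factor is at least one. [folklore] -/
theorem one_le_L : 1 ≤ L := Nat.one_le_iff_ne_zero.2 (NeZero.ne L)

/-- `L^{min(j,n)} ≤ L^j`. [folklore] -/
theorem side_le_pow (j : ℕ) : (side n L j : ℝ) ≤ (L : ℝ) ^ j := by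
  unfold side
  push_cast
  exact pow_le_pow_right₀ (by exact_mod_cast one_le_L L) (min_le_left j n)

/-- Binder `htri`: the two-stop triangle inequality. [folklore] -/
theorem rho_triangle (x z w y : TPt d (N * L ^ n)) :
    rho d n N L x y ≤ rho d n N L x z + rho d n N L z w + rho d n N L w y := by
  unfold rho
  calc pl1 (x - y) ≤ pl1 (x - w) + pl1 (w - y) := pl1_sub_triangle x w y
    _ ≤ pl1 (x - z) + pl1 (z - w) + pl1 (w - y) := add_le_add (pl1_sub_triangle x z w) le_rfl

/-- Binder `hρbd` with `c = d`: **fine distance ≤ L^j·(block distance) + d·L^j**. [folklore] -/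
theorem rho_le_nbd (j : ℕ) (x z : TPt d (N * L ^ n)) :
    rho d n N L x z ≤ (L : ℝ) ^ j * nbd d n N L j (cube d n N L j x) (cube d n N L j z) + d * (L : ℝ) ^ j := by
  have h := pl1_sub_le_blockPt (d := d) (fine_eq_levM_mul_side n N L j) x z
  have hs := side_le_pow n L j
  have hnb : pl1 (blockPt (levM n N L j) (side n L j) x - blockPt (levM n N L j) (side n L j) z)
      = (nbd d n N L j (cube d n N L j x) (cube d n N L j z) : ℝ) := (cast_npl1 _).symm
  rw [hnb] at h
  unfold rho
  have hn : (0 : ℝ) ≤ nbd d n N L j (cube d n N L j x) (cube d n N L j z) := Nat.cast_nonneg _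
  have hd : (0 : ℝ) ≤ d := Nat.cast_nonneg _
  nlinarith

/-- Binder `hnest`: **level-`j` blocks refine level-`(j+1)` blocks**. [folklore] -/
theorem cube_nest (j : ℕ) {z w : TPt d (N * L ^ n)} (h : cube d n N L j z = cube d n N L j w) :
    cube d n N L (j + 1) z = cube d n N L (j + 1) w :=
  blockPt_nest (fine_eq_levM_mul_side n N L j) (side_dvd_side_succ n L j) h

/-- Binder `hdiam` with `c = d`: **a level-`(j+1)` block has `ρ`-diameter ≤ d·L^{j+1}**. [folklore] -/
theorem rho_le_of_cube_succ_eq (j : ℕ) {z w : TPt d (N * L ^ n)}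
    (h : cube d n N L (j + 1) z = cube d n N L (j + 1) w) : rho d n N L z w ≤ d * (L : ℝ) ^ (j + 1) := by
  have h1 := pl1_sub_le_of_blockPt_eq (fine_eq_levM_mul_side n N L (j + 1)) h
  have hs := side_le_pow n L (j + 1)
  unfold rho
  have hd : (0 : ℝ) ≤ d := Nat.cast_nonneg _
  nlinarith

/-- Binder `hcount` with `A′ = 2^d`, `p = d`: **at most `2^d(r+1)^d` level-`j` blocks at block distance exactly `r`**
from a given block, uniformly in the level and the volume. [folklore] -/
theorem card_nbd_eq_le (j : ℕ) (b₀ : TPt d (levM n N L j)) (r : ℕ) :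
    ((Finset.univ.filter fun b => nbd d n N L j b₀ b = r).card : ℝ) ≤ (2 : ℝ) ^ d * ((r : ℝ) + 1) ^ d :=
  card_sphere_le b₀ r

/-- Binder `hlen`: every level-`j` site has length `L^j`. [folklore] -/
theorem len_torusGeom (Mbig : ℝ) (dist : ∀ j : ℕ, TPt d (levM n N L j) → TPt d (levM n N L j) → ℝ) (j : ℕ)
    (y : TPt d (levM n N L j)) : (torusGeom d n N L Mbig dist j).len y = (L : ℝ) ^ j :=
  len_blockGeom _ _ _ _ _ y

/-- Binder `hbd` for the minimal admissible distance: the integer block distance IS `nbdDist`. [folklore] -/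
theorem nbd_le_nbdDist (Mbig : ℝ) (j : ℕ) (y y₁ : TPt d (levM n N L j)) :
    (nbd d n N L j y y₁ : ℝ) ≤ (torusGeom d n N L Mbig (nbdDist d n N L) j).dist y y₁ := le_rfl

/-- **THE SLICE BOUNDS `hg` ON THE TORUS FROM (3.42)/(3.49) OF PRINTED TYPE — geometry and dictionaries discharged.**
On the fine torus `(ℤ/NLⁿ)^d` with its nested block structure, let per level `j`: `A j m U` be four background-dependent
matrices carried as the `B9.KernelFamily` `matrixFamily` of the level-`j` block geometry, with `A j 0 (U j) = G j`
(the auxiliary propagator) and `A j 1 (U j) = (G j·D)ᵀ` (its covariant derivative, transposed — Hermiticity [model]);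
`F j n U` four matrices carried as the `B9.FineKernel` `fineKernelOf`, with `F j 3 (U j) = Ng j` (the gauge-fixing
kernel); `K j = massKernel (cube j) (τ j) (a_j/(L^j)^{d+2}) + Ng j` the operator model.  HYPOTHESES OF PRINTED TYPE,
BY NAME, and nothing else analytic: `h342 : ∀ j, B9.Ineq342_346_347 (matrixFamily … (A j)) B₀ δ₀ (U j)` and
`h349 : ∀ j, B9.Ineq349 d (fineKernelOf … (F j)) C₃ δ₁ (U j)` with LEVEL-FREE constants (for the model carriers these
unfold to exactly the cube-sup bounds of (3.42) items and the two-block sup bounds of (3.49) items —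
`ineq342_matrixFamily_iff`, `ineq349_fineKernelOf_iff`).  CONCLUSION: King's (3.63) shape for EVERY slice,
`|sliceKernel G K D i x y| ≤ C_A(1 + C_A·C_P)·e^{−δρ(x,y)/L^i}/(L^i)^{d−1}` with
`C_A = printedCA B₀ δ₀ δ d 2^d d`, `C_P = printedCP a C₃ δ₁ δ L d d` — the geometry binders (but `hbd`, kept
relative to the free site distance `dist j ≥ nbd j`; `nbd_le_nbdDist` for the block distance) and the three dictionary
binders of `sliceKernel_bound_of_printedType` are theorems of this file.  HONEST: the READING that B9's
Theorem 3.1/3.3 and (3.49) give `h342`/`h349` for the auxiliary propagators of the resolvent telescoping (thresholds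
`M ≥ M₁`, `Mα₀ ≤ a₀`, class (3.35) per level; `d(y,y′)` ≥ block distance) is NOT made here — they stay hypotheses;
no conditional of the cell (`BetaPertH`, (B), (B^μ)) is touched. [folklore] -/
theorem sliceKernel_bound_torus_of_printedType (Mbig : ℝ)
    (dist : ∀ j : ℕ, TPt d (levM n N L j) → TPt d (levM n N L j) → ℝ)
    (Bg : ℕ → B9.Backgrounds) (U : ∀ j, (Bg j).Cfg)
    (A F : ∀ j, Fin 4 → (Bg j).Cfg → Matrix (TPt d (N * L ^ n)) (TPt d (N * L ^ n)) ℝ)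
    (G Ng K : ℕ → Matrix (TPt d (N * L ^ n)) (TPt d (N * L ^ n)) ℝ)
    (D : Matrix (TPt d (N * L ^ n)) (TPt d (N * L ^ n)) ℝ)
    (τ : ℕ → TPt d (N * L ^ n) → TPt d (N * L ^ n) → ℝ) (am : ℕ → ℝ) {B₀ δ₀ C₃ δ₁ δ a : ℝ}
    (hd : 1 ≤ d) (hB₀ : 0 ≤ B₀) (hC₃ : 0 ≤ C₃) (hδ : 0 ≤ δ) (hδ₀ : δ < δ₀) (hδ₁ : δ ≤ δ₁ / 2) (ha : 0 ≤ a)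
    (hbd : ∀ j y y₁, (nbd d n N L j y y₁ : ℝ) ≤ dist j y y₁)
    (hA0 : ∀ j, A j 0 (U j) = G j) (hA1 : ∀ j, A j 1 (U j) = (G j * D).transpose)
    (hF3 : ∀ j, F j 3 (U j) = Ng j)
    (h342 : ∀ j, B9.Ineq342_346_347
      (matrixFamily (cube d n N L j) (dist j) j (L : ℝ) Mbig (A j)) B₀ δ₀ (U j))
    (h349 : ∀ j, B9.Ineq349 d
      (fineKernelOf (cube d n N L j) (dist j) j (L : ℝ) Mbig (F j)) C₃ δ₁ (U j))
    (hτ : ∀ j z w, |τ j z w| ≤ 1) (ham : ∀ j, 0 ≤ am j ∧ am j ≤ a)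
    (hK : ∀ j, K j = massKernel (cube d n N L j) (τ j) (am j / ((L : ℝ) ^ j) ^ (d + 2)) + Ng j) :
    ∀ i x y, |sliceKernel G K D i x y|
      ≤ printedCA B₀ δ₀ δ d ((2 : ℝ) ^ d) d * (1 + printedCA B₀ δ₀ δ d ((2 : ℝ) ^ d) d * printedCP a C₃ δ₁ δ L d d)
        * (Real.exp (-(δ * (rho d n N L x y / (L : ℝ) ^ i))) / ((L : ℝ) ^ i) ^ (d - 1)) := by
  have hL : (1 : ℝ) ≤ L := by exact_mod_cast one_le_L L
  refine sliceKernel_bound_of_printedType (torusGeom d n N L Mbig dist) Bg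
    (fun j => matrixFamily (cube d n N L j) (dist j) j (L : ℝ) Mbig (A j))
    (fun j => fineKernelOf (cube d n N L j) (dist j) j (L : ℝ) Mbig (F j)) U
    (cube d n N L) (nbd d n N L) G Ng K D τ am (rho d n N L) hd hL hB₀ hC₃ hδ hδ₀ hδ₁ (by positivity) ha
    (rho_nonneg d n N L) (rho_comm d n N L) (rho_triangle d n N L) (len_torusGeom d n N L Mbig dist)
    hbd (rho_le_nbd d n N L) (card_nbd_eq_le d n N L)
    (fun j z w h => cube_nest d n N L j h) (fun j z w h => rho_le_of_cube_succ_eq d n N L j h)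
    h342 h349 (fun j => ?_) (fun j => ?_) (fun j => ?_) hτ ham hK
  · rw [← hA0 j]
    exact rowObservedBy_matrixFamily _ _ _ _ _ (A j) (U j) 0
  · rw [← hA1 j]
    exact rowObservedBy_matrixFamily _ _ _ _ _ (A j) (U j) 1
  · rw [← hF3 j]
    exact entryDominated_fineKernelOf _ _ _ _ _ (F j) (U j) 3

end Tower

/-! ## §5c  NO HIDDEN STRENGTH: the by-name hypotheses of §5b for the model family FOLLOW from level-free kernel
bounds holding at every configuration (so they are satisfiable, and exactly as strong as the kernel-bound families
up to Bałaban's thresholds, which the model ignores) -/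
section NoHiddenStrength

variable (d n N L : ℕ) [NeZero N] [NeZero L]

/-- `B9.Thm31Printed` for the torus model family from LEVEL-FREE cube-localised row bounds at every configuration:
witnesses `M₁ = a₀ = 1`, the given `B₀, δ₀ > 0`, Hölder constants `0` (`ineq343_345_matrixFamily`). [folklore] -/
theorem thm31Printed_torus_of_rowBounds (M c35 : ℝ) (Bg : ℕ → B9.Backgrounds)
    (dist : ∀ j : ℕ, TPt d (levM n N L j) → TPt d (levM n N L j) → ℝ)
    (A : ∀ j : ℕ, Fin 4 → (Bg j).Cfg → Matrix (TPt d (N * L ^ n)) (TPt d (N * L ^ n)) ℝ) {B₀ δ₀ : ℝ}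
    (hB₀ : 0 < B₀) (hδ₀ : 0 < δ₀)
    (h : ∀ j (U : (Bg j).Cfg) (m : Fin 4) x y₁,
      ∑ z ∈ Finset.univ.filter (fun z => cube d n N L j z = y₁), |A j m U x z|
        ≤ B₀ * B9.pref4 ((L : ℝ) ^ j) m * Real.exp (-(δ₀ * dist j (cube d n N L j x) y₁))) :
    B9.Thm31Printed c35 (fun j => torusGeom d n N L M dist j) Bg
      (fun j => matrixFamily (cube d n N L j) (dist j) j (L : ℝ) M (A j)) :=
  ⟨1, δ₀, 1, B₀, fun _ => 0, fun _ => 0, fun _ _ => 0, one_pos, hδ₀, one_pos, hB₀,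
    fun j _ _ _ _ U _ =>
      ⟨ineq342_matrixFamily_of_rowBounds _ _ j M (A j) U hB₀.le (Nat.cast_nonneg L) (h j U),
        ineq343_345_matrixFamily _ _ j (L : ℝ) M (A j) δ₀ U⟩⟩

/-- `B9.Stmt349Printed` for the torus model family from LEVEL-FREE entry bounds at every configuration. [folklore] -/
theorem stmt349Printed_torus_of_entryBounds (M c35 : ℝ) (Bg : ℕ → B9.Backgrounds)
    (dist : ∀ j : ℕ, TPt d (levM n N L j) → TPt d (levM n N L j) → ℝ)
    (F : ∀ j : ℕ, Fin 4 → (Bg j).Cfg → Matrix (TPt d (N * L ^ n)) (TPt d (N * L ^ n)) ℝ) {C δ₀ : ℝ}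
    (hC : 0 < C) (hδ₀ : 0 < δ₀)
    (h : ∀ j (U : (Bg j).Cfg) (m : Fin 4) z w,
      |F j m U z w| ≤ C * B9.pref4inv ((L : ℝ) ^ j) m * ((L : ℝ) ^ j) ^ (-(d : ℝ))
        * Real.exp (-(δ₀ / 2 * dist j (cube d n N L j z) (cube d n N L j w)))) :
    B9.Stmt349Printed d c35 (fun j => torusGeom d n N L M dist j) Bg
      (fun j => fineKernelOf (cube d n N L j) (dist j) j (L : ℝ) M (F j)) :=
  ⟨1, δ₀, 1, C, one_pos, hδ₀, one_pos, hC, fun j _ _ _ _ U _ =>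
    ineq349_fineKernelOf_of_entryBounds _ _ j M (F j) U hC.le
      (by exact_mod_cast Nat.pos_of_ne_zero (NeZero.ne L)) (h j U)⟩

end NoHiddenStrength

/-! ## §6  Examples (the definitions compute; the bounds of §1 are attained) -/
section Examples

/-- Blocks of two residues on `ℤ/6`: the residue `5` lies in block `2 = ⌊5/2⌋` of `ℤ/3`. -/
example : blockOf 3 2 (5 : ZMod 6) = 2 := by decide

/-- `pabs_sub_le_of_blockOf_eq` is ATTAINED: on `ℤ/4` with blocks `{0,1}`, `{2,3}` the residues `0`, `1` share block `0`
and are at periodic distance exactly `e − 1 = 1`. -/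
example : blockOf 2 2 (1 : ZMod 4) = blockOf 2 2 (0 : ZMod 4) ∧ pabs ((1 : ZMod 4) - 0) = 1 := by
  refine ⟨by decide, ?_⟩
  rw [sub_zero, pabs]
  decide

/-- `pabs_sub_le_blockOf` is ATTAINED across blocks: on `ℤ/4`, the residues `0` and `3` are at periodic distance `1`
(wrap-around), their blocks `0`, `1 ∈ ℤ/2` at periodic distance `1`: `1 ≤ 2·1 + 1` — and for `1`, `2` (distance `1`,
blocks `0`, `1`): `1 ≤ 2·1 + 1`; the in-block term is needed for `0`, `1` above (`1 ≤ 2·0 + 1`, equality). -/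
example : pabs ((0 : ZMod 4) - 3) = 1 ∧ pabs (blockOf 2 2 (0 : ZMod 4) - blockOf 2 2 (3 : ZMod 4)) = 1 := by
  constructor
  · rw [pabs]; decide
  · rw [pabs]; decide

/-- The nesting arithmetic `NLⁿ = (NL^{n−j})·L^{min(j,n)}` past the top level: `j = n + 3` gives `N·1·Lⁿ`. -/
example (N L n : ℕ) : N * L ^ n = levM n N L (n + 3) * side n L (n + 3) := fine_eq_levM_mul_side n N L (n + 3)

/-- The integer block distance on `(ℤ/5)²`: the points `(0,0)` and `(4,2)` are at periodic ℓ¹ distance `1 + 2 = 3`. -/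
example : npl1 (![(0 : ZMod 5), 0] - ![4, 2]) = 3 := by decide

end Examples

end Summit.QuantumFields.BalabanUV.T4Continuum.SliceTorusTower
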